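import Mathlib
import HarnessLib
import Summits.HubbardSuperconductivity.HubbardSuperconductivity.Theses.ChiralWindow
import Summits.HubbardSuperconductivity.HubbardSuperconductivity.Theorems.ChiralWindowCwChiralConstructionResidual
import Summits.HubbardSuperconductivity.HubbardSuperconductivity.Theorems.ChiralWindowCwChannelInfContinuousFilling
import Summits.HubbardSuperconductivity.HubbardSuperconductivity.Theorems.ChiralWindowCwKLChiralWindowStubKlFillingLower

/-!
# Crux `CwChiralConstruction` (stmt-HubbardSuperconductivity-1740): the ladder-scale transfer (record-free part)

Route `HubbardSuperconductivity/ChiralWindow`, rank-2 crux ("the programme"). Support file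
(`--supports stmt-HubbardSuperconductivity-1740`), line `ladder-scale-transfer`
(`Cruxes/CwChiralConstruction/Lines/ladder_scale_transfer.lean`, lead c4, 2026-08-17).

The line shares three kernel-level stubs VERBATIM with the sibling crux stmt-2010's line
`ladder-scale-certified-chain` ((K1) Kohn–Luttinger `B₁g` leading at `U = 1` on `μ ∈ [-9/10,-3/10]`; (R1) the
symmetric flow to a ladder scale `s ≥ e^{-C₁/U²}` certified for every GRASSMANN chemical potential
`ν ∈ [-17/20, -7/20]`; (B) ladder-scale certificate ⇒ `c·s ≤ dWaveOrderParameter U (ν + U/2)`). Their composite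
is an ORDER FLOOR ON THE GRASSMANN WINDOW, read on the operator side at `μ = ν + U/2`:

  `∃ U₀ C > 0, ∀ U ∈ (0,U₀), ∀ ν ∈ [-17/20,-7/20], e^{-C/U²} ≤ dWaveOrderParameter U (ν + U/2)`.   (F)

This file proves, with no reference to the certificate record, that (F) plus ONE free-filling inequality
`n(-21/25) < 7/10` implies the crux (`stub_cruxOfOrderFloorOnGrassmannWindow`, registered sub-goal of the crux, arrow form): on the `μ`-window
`[-169/200, -21/25]` the free fillings lie strictly inside `(13/25, 7/10)` (`13/25 ≤ n(-111/100) < n(-169/200)`,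
`stub_klFillingLower` + `strictMonoOn_filling`; monotonicity inside; the inequality at the top), for
`U < min U₀ (1/100)` and `μ` in the open window `ν := μ - U/2 ∈ [-17/20, -7/20]` and (F) gives the floor at
`ν + U/2 = μ`, and c1's landed frame `cwChiralConstruction_of_orderOnOpenSet` (generic-`μ` density via
`cw_genericDensity`, p96959) concludes. Unlike the sibling crux (quantifier order `∃δ ∀U`), NO equation-of-state
input is needed: the crux's `∃ δ` per `U` is discharged at a generic chemical potential.

Also recorded: the same transfer from a floor stated directly on an operator-side `μ`-window containing
`[-169/200, -21/25]` (`cwChiralConstruction_of_orderFloorOnMuWindow`), which is what (F) yields for `U ≤ 1/100`.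
No definitions; everything is proved. [folklore: Griffiths 1964 + the cited tree lemmas]
-/

set_option linter.dupNamespace false

namespace Summit.HubbardSuperconductivity.HubbardSuperconductivity.Theorems

open Literature.MathematicalPhysics.QuantumLattice Filter
open Summit.HubbardSuperconductivity.HubbardSuperconductivity.Theses.ChiralWindow
open scoped Topology

/-- **Transfer from an operator-side `μ`-window.** If the free filling at `-21/25` is `< 7/10` and, for every
`U ∈ (0, U₀)`, `e^{-C/U²} ≤ dWaveOrderParameter U μ` for all `μ` in the open window `(-169/200, -21/25)`, then
`CwChiralConstruction`: the closed window's free fillings lie in `[13/25 + η, 7/10 - η]`,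
`η = min (n(-169/200) - 13/25) (7/10 - n(-21/25)) > 0` (`13/25 ≤ n(-111/100) < n(-169/200)` by
`stub_klFillingLower` and `strictMonoOn_filling`, `monotone_filling` inside), and c1's frame
`cwChiralConstruction_of_orderOnOpenSet` applies. [folklore: Griffiths 1964 + landed tree lemmas] -/
theorem cwChiralConstruction_of_orderFloorOnMuWindow
    (hT : KohnLuttinger.filling (squareDispersion 1 0) (-(21:ℝ) / 25) < 7 / 10)
    (h : ∃ U₀ C : ℝ, 0 < U₀ ∧ 0 < C ∧ ∀ U ∈ Set.Ioo (0:ℝ) U₀,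
      ∀ μ ∈ Set.Ioo (-(169:ℝ) / 200) (-(21:ℝ) / 25), Real.exp (-C / U ^ 2) ≤ dWaveOrderParameter U μ) :
    CwChiralConstruction := by
  obtain ⟨U₀, C, hU₀, hC, H⟩ := h
  -- the free fillings at the two ends of the `μ`-window
  have hlow : (13 : ℝ) / 25 < KohnLuttinger.filling (squareDispersion 1 0) (-(169:ℝ) / 200) := by
    have hmono := strictMonoOn_filling
      (show (-111 / 100 : ℝ) ∈ Set.Icc (-4 : ℝ) 4 by constructor <;> norm_num)
      (show (-(169:ℝ) / 200) ∈ Set.Icc (-4 : ℝ) 4 by constructor <;> norm_num)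
      (by norm_num : (-111 / 100 : ℝ) < -(169:ℝ) / 200)
    exact lt_of_le_of_lt stub_klFillingLower hmono
  set η : ℝ := min (KohnLuttinger.filling (squareDispersion 1 0) (-(169:ℝ) / 200) - 13 / 25)
    (7 / 10 - KohnLuttinger.filling (squareDispersion 1 0) (-(21:ℝ) / 25)) with hηdef
  have hη : 0 < η := lt_min (by linarith) (by linarith)
  have hη₁ : η ≤ KohnLuttinger.filling (squareDispersion 1 0) (-(169:ℝ) / 200) - 13 / 25 := min_le_left _ _
  have hη₂ : η ≤ 7 / 10 - KohnLuttinger.filling (squareDispersion 1 0) (-(21:ℝ) / 25) := min_le_right _ _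
  refine cwChiralConstruction_of_orderOnOpenSet ⟨η, U₀, C, hη, hU₀, hC, fun U hU => ?_⟩
  refine ⟨-(169:ℝ) / 200, -(21:ℝ) / 25, by norm_num, fun μ hμ => ?_, fun μ hμ => H U hU μ hμ⟩
  have h1 : KohnLuttinger.filling (squareDispersion 1 0) (-(169:ℝ) / 200) ≤
      KohnLuttinger.filling (squareDispersion 1 0) μ := monotone_filling hμ.1
  have h2 : KohnLuttinger.filling (squareDispersion 1 0) μ ≤
      KohnLuttinger.filling (squareDispersion 1 0) (-(21:ℝ) / 25) := monotone_filling hμ.2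
  exact ⟨by linarith, by linarith⟩

/-- **Registered sub-goal `stub_cruxOfOrderFloorOnGrassmannWindow` — transfer from the Grassmann window (record-free
form of line `ladder-scale-transfer`'s composition).** If the
free filling at `-21/25` is `< 7/10` and, for every `U ∈ (0, U₀)` and every Grassmann chemical potential
`ν ∈ [-17/20, -7/20]`, the operator-side order parameter at `μ = ν + U/2` satisfies
`e^{-C/U²} ≤ dWaveOrderParameter U (ν + U/2)` — the composite conclusion of the shared stubs (K1), (R1), (B) of
cruxes stmt-1740 / stmt-2010 — then `CwChiralConstruction`: for `U < min U₀ (1/100)` and `μ ∈ (-169/200, -21/25)`,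
`ν := μ - U/2 ∈ [-17/20, -7/20]`, so the floor holds at `ν + U/2 = μ`; conclude with
`cwChiralConstruction_of_orderFloorOnMuWindow`. [folklore] -/
theorem stub_cruxOfOrderFloorOnGrassmannWindow :
    KohnLuttinger.filling (squareDispersion 1 0) (-(21:ℝ) / 25) < 7 / 10 → (∃ U₀ C : ℝ, 0 < U₀ ∧ 0 < C ∧ ∀ U ∈ Set.Ioo (0:ℝ) U₀, ∀ ν ∈ Set.Icc (-(17:ℝ) / 20) (-(7:ℝ) / 20), Real.exp (-C / U ^ 2) ≤ dWaveOrderParameter U (ν + U / 2)) → CwChiralConstruction := by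
  rintro hT ⟨U₀, C, hU₀, hC, H⟩
  refine cwChiralConstruction_of_orderFloorOnMuWindow hT
    ⟨min U₀ (1 / 100), C, lt_min hU₀ (by norm_num), hC, fun U hU μ hμ => ?_⟩
  have hUU₀ : U < U₀ := lt_of_lt_of_le hU.2 (min_le_left _ _)
  have hU100 : U < 1 / 100 := lt_of_lt_of_le hU.2 (min_le_right _ _)
  have hν : μ - U / 2 ∈ Set.Icc (-(17:ℝ) / 20) (-(7:ℝ) / 20) := by
    constructor <;> linarith [hμ.1, hμ.2, hU.1]
  have := H U ⟨hU.1, hUU₀⟩ (μ - U / 2) hν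
  rwa [sub_add_cancel] at this

end Summit.HubbardSuperconductivity.HubbardSuperconductivity.Theorems
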